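import Mathlib.Combinatorics.SimpleGraph.Acyclic
import Literature.AnabelianGeometry.SemiGraphs.SemiGraph

/-!
# Semi-graphs: lemmas on the barycentric subdivision ([SemiAnbd] §1, pp. 11–13)

Mochizuki, *Semi-graphs of Anabelioids*, Publ. RIMS **42** (2006) 221–322, §1, author's manuscript
pp. 11–13 [cite: MochizukiSemiAnbd2006, §1 pp.11-13].  `SemiGraph.lean` renders the topological
space of a semi-graph `G` combinatorially, by the simple graph `G.subdivision` on
`G.Node = vertices ⊕ (edges ⊕ branches)` (an edge-point is adjacent to its branch-points, a
branch-point to the vertex it abuts to); `IsConnected` / `IsTree` are defined through it.  This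
proof-only file (no new definitions) collects the elementary facts about `G.subdivision` used to
discharge the printed claims of §1 (the trees `G[v]`, `G[e]`, `G[b]` of p. 13, Lemma 1.8, …):

* the adjacency relation made explicit (`subdivision_adj_iff` and the three inversion lemmas
  `subdivision_adj_inl_iff`, `subdivision_adj_edge_iff`, `subdivision_adj_branch_iff`);
* functoriality: a morphism of semi-graphs maps adjacent nodes to adjacent nodes;
* a cut criterion for acyclicity of `SimpleGraph.fromRel`, and two acyclicity criteria for the
  subdivision: every vertex receives at most one branch, or every edge has at most one abutting
  branch.

Deliberately NOT here: anything topological; statements about specific semi-graphs.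
-/

namespace Literature.AnabelianGeometry.SemiGraphs

namespace SemiGraph

open CategoryTheory

universe u

/-! ### A cut criterion for acyclicity of `SimpleGraph.fromRel` -/

/-- Cut criterion: if every generating pair `r v w` is separated by a set `S` of vertices that no
other generating pair crosses, then every edge of `SimpleGraph.fromRel r` is a bridge, so the graph is
acyclic.  (Elementary; the tool behind "`G[v]`, `G[e]`, `G[b]` are all trees", [SemiAnbd] §1 p. 13.)
[cite: MochizukiSemiAnbd2006, §1 p.13] -/
theorem isAcyclic_fromRel_of_cut {V : Type u} {r : V → V → Prop}
    (h : ∀ ⦃v w : V⦄, r v w → ∃ S : Set V, ¬ (v ∈ S ↔ w ∈ S) ∧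
      ∀ ⦃x y : V⦄, r x y → s(x, y) ≠ s(v, w) → (x ∈ S ↔ y ∈ S)) :
    (SimpleGraph.fromRel r).IsAcyclic := by
  rw [SimpleGraph.isAcyclic_iff_forall_adj_isBridge]
  intro v w hvw
  rw [SimpleGraph.fromRel_adj] at hvw
  obtain ⟨-, hr⟩ := hvw
  have key : ∃ S : Set V, ¬ (v ∈ S ↔ w ∈ S) ∧
      ∀ ⦃x y : V⦄, r x y → s(x, y) ≠ s(v, w) → (x ∈ S ↔ y ∈ S) := by
    rcases hr with h1 | h1
    · exact h h1
    · obtain ⟨S, hS, hc⟩ := h h1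
      refine ⟨S, fun h' => hS h'.symm, fun x y hxy hne => hc hxy ?_⟩
      have e1 : s(w, v) = s(v, w) := Sym2.eq_swap
      rw [e1]
      exact hne
  obtain ⟨S, hS, hc⟩ := key
  rw [SimpleGraph.isBridge_iff]
  rintro ⟨p⟩
  apply hS
  suffices aux : ∀ {a b : V} (_ : ((SimpleGraph.fromRel r).deleteEdges {s(v, w)}).Walk a b),
      (a ∈ S ↔ b ∈ S) from aux p
  intro a b q
  induction q with
  | nil => exact Iff.rfl
  | cons hadj _ ih =>
    rw [SimpleGraph.deleteEdges_adj, SimpleGraph.fromRel_adj, Set.mem_singleton_iff] at hadj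
    obtain ⟨⟨-, hr' | hr'⟩, hne'⟩ := hadj
    · exact (hc hr' hne').trans ih
    · refine (hc hr' ?_).symm.trans ih
      intro heq
      apply hne'
      rw [← heq]
      exact Sym2.eq_swap

/-! ### The adjacency of the barycentric subdivision, made explicit -/

variable (G : SemiGraph.{u})

/-- The generating incidence relation of the subdivision, as a disjunction of its two constructors.
[cite: MochizukiSemiAnbd2006, §1 pp.11-12] -/
theorem nodeRel_iff {x y : G.Node} : G.NodeRel x y ↔
    (∃ b : G.Branch, x = Sum.inr (Sum.inl (G.edgeOf b)) ∧ y = Sum.inr (Sum.inr b)) ∨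
    (∃ (b : G.Branch) (v : G.Vertex), G.abuts b = some v ∧
      x = Sum.inr (Sum.inr b) ∧ y = Sum.inl v) := by
  constructor
  · rintro (⟨b⟩ | ⟨b, v, h⟩)
    · exact Or.inl ⟨b, rfl, rfl⟩
    · exact Or.inr ⟨b, v, h, rfl, rfl⟩
  · rintro (⟨b, rfl, rfl⟩ | ⟨b, v, h, rfl, rfl⟩)
    · exact NodeRel.edge_branch b
    · exact NodeRel.branch_vertex b v h

/-- Two nodes related by the incidence relation are distinct (they have different types).
[cite: MochizukiSemiAnbd2006, §1 pp.11-12] -/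
theorem NodeRel.ne {x y : G.Node} (h : G.NodeRel x y) : x ≠ y := by
  rcases h with ⟨b⟩ | ⟨b, v, h⟩
  · simp
  · simp

/-- Adjacency in the subdivision is the symmetrised incidence relation.
[cite: MochizukiSemiAnbd2006, §1 pp.11-12] -/
theorem subdivision_adj_iff {x y : G.Node} :
    G.subdivision.Adj x y ↔ G.NodeRel x y ∨ G.NodeRel y x := by
  change (SimpleGraph.fromRel G.NodeRel).Adj x y ↔ _
  rw [SimpleGraph.fromRel_adj]
  constructor
  · exact fun h => h.2
  · rintro (h | h)
    · exact ⟨NodeRel.ne G h, Or.inl h⟩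
    · exact ⟨(NodeRel.ne G h).symm, Or.inr h⟩

/-- An incidence gives an adjacency of the subdivision. [cite: MochizukiSemiAnbd2006, §1 pp.11-12] -/
theorem subdivision_adj_of_nodeRel {x y : G.Node} (h : G.NodeRel x y) : G.subdivision.Adj x y :=
  (G.subdivision_adj_iff).mpr (Or.inl h)

/-- The neighbours of a vertex-point are the points of the branches abutting to that vertex.
[cite: MochizukiSemiAnbd2006, §1 pp.11-12] -/
theorem subdivision_adj_inl_iff (v : G.Vertex) (y : G.Node) :
    G.subdivision.Adj (Sum.inl v) y ↔ ∃ b : G.Branch, G.abuts b = some v ∧ y = Sum.inr (Sum.inr b) := by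
  rw [subdivision_adj_iff, nodeRel_iff, nodeRel_iff]
  constructor
  · rintro ((⟨b, h1, -⟩ | ⟨b, u, -, h1, -⟩) | (⟨b, -, h1⟩ | ⟨b, u, hb, h1, h2⟩))
    · simp at h1
    · simp at h1
    · simp at h1
    · have huv : u = v := by simpa using h2.symm
      subst huv
      exact ⟨b, hb, h1⟩
  · rintro ⟨b, hb, rfl⟩
    exact Or.inr (Or.inr ⟨b, v, hb, rfl, rfl⟩)

/-- The neighbours of an edge-point are the points of the branches of that edge.
[cite: MochizukiSemiAnbd2006, §1 pp.11-12] -/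
theorem subdivision_adj_edge_iff (e : G.Edge) (y : G.Node) :
    G.subdivision.Adj (Sum.inr (Sum.inl e)) y ↔
      ∃ b : G.Branch, G.edgeOf b = e ∧ y = Sum.inr (Sum.inr b) := by
  rw [subdivision_adj_iff, nodeRel_iff, nodeRel_iff]
  constructor
  · rintro ((⟨b, h1, h2⟩ | ⟨b, u, -, h1, -⟩) | (⟨b, -, h1⟩ | ⟨b, u, -, -, h1⟩))
    · exact ⟨b, by simpa using h1.symm, h2⟩
    · simp at h1
    · simp at h1
    · simp at h1
  · rintro ⟨b, rfl, rfl⟩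
    exact Or.inl (Or.inl ⟨b, rfl, rfl⟩)

/-- The neighbours of a branch-point are the point of its edge and the vertex it abuts to (if any).
[cite: MochizukiSemiAnbd2006, §1 pp.11-12] -/
theorem subdivision_adj_branch_iff (b : G.Branch) (y : G.Node) :
    G.subdivision.Adj (Sum.inr (Sum.inr b)) y ↔
      y = Sum.inr (Sum.inl (G.edgeOf b)) ∨ ∃ v : G.Vertex, G.abuts b = some v ∧ y = Sum.inl v := by
  rw [subdivision_adj_iff, nodeRel_iff, nodeRel_iff]
  constructor
  · rintro ((⟨c, h1, -⟩ | ⟨c, u, hc, h1, h2⟩) | (⟨c, h1, h2⟩ | ⟨c, u, -, -, h1⟩))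
    · simp at h1
    · have hcb : c = b := by simpa using h1.symm
      subst hcb
      exact Or.inr ⟨u, hc, h2⟩
    · have hcb : c = b := by simpa using h2.symm
      subst hcb
      exact Or.inl h1
    · simp at h1
  · rintro (rfl | ⟨v, hb, rfl⟩)
    · exact Or.inr (Or.inl ⟨b, rfl, rfl⟩)
    · exact Or.inl (Or.inr ⟨b, v, hb, rfl, rfl⟩)

/-- In the subdivision, the point of an edge is joined to the points of its branches.
[cite: MochizukiSemiAnbd2006, §1 pp.11-12] -/
theorem subdivision_reachable_edge_branch (b : G.Branch) :
    G.subdivision.Reachable (Sum.inr (Sum.inl (G.edgeOf b))) (Sum.inr (Sum.inr b)) :=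
  (G.subdivision_adj_of_nodeRel (NodeRel.edge_branch b)).reachable

/-- In the subdivision, the point of a branch is joined to the vertex it abuts to.
[cite: MochizukiSemiAnbd2006, §1 pp.11-12] -/
theorem subdivision_reachable_branch_vertex {b : G.Branch} {v : G.Vertex}
    (h : G.abuts b = some v) :
    G.subdivision.Reachable (Sum.inr (Sum.inr b)) (Sum.inl v) :=
  (G.subdivision_adj_of_nodeRel (NodeRel.branch_vertex b v h)).reachable

/-! ### Functoriality: a morphism of semi-graphs respects the incidence relation -/

variable {G}

/-- A morphism of semi-graphs maps incident nodes to incident nodes (p. 11: morphisms are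
compatible with the edges and with the coincidence maps). [cite: MochizukiSemiAnbd2006, §1 p.11] -/
theorem NodeRel.map {G' : SemiGraph.{u}} (φ : G ⟶ G') {x y : G.Node} (h : G.NodeRel x y) :
    G'.NodeRel (Sum.map φ.vertexMap (Sum.map φ.edgeMap φ.branchMap) x)
      (Sum.map φ.vertexMap (Sum.map φ.edgeMap φ.branchMap) y) := by
  rcases h with ⟨b⟩ | ⟨b, v, h⟩
  · have h1 := NodeRel.edge_branch (G := G') (φ.branchMap b)
    rw [φ.edgeOf_branchMap] at h1
    exact h1
  · exact NodeRel.branch_vertex _ _ (φ.abuts_branchMap b v h)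

/-- A morphism of semi-graphs maps adjacent nodes of the subdivision to adjacent nodes.
[cite: MochizukiSemiAnbd2006, §1 p.11] -/
theorem subdivision_adj_map {G' : SemiGraph.{u}} (φ : G ⟶ G') {x y : G.Node}
    (h : G.subdivision.Adj x y) :
    G'.subdivision.Adj (Sum.map φ.vertexMap (Sum.map φ.edgeMap φ.branchMap) x)
      (Sum.map φ.vertexMap (Sum.map φ.edgeMap φ.branchMap) y) := by
  rw [subdivision_adj_iff] at h ⊢
  rcases h with h | h
  · exact Or.inl (h.map φ)
  · exact Or.inr (h.map φ)

variable (G)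

/-! ### Two acyclicity criteria for the subdivision -/

/-- If every vertex of `G` receives at most one branch, the barycentric subdivision of `G` is acyclic
(every adjacency is cut off by an explicit set of nodes).  Applies to `G[e]` and `G[b]` (p. 13).
[cite: MochizukiSemiAnbd2006, §1 p.13] -/
theorem subdivision_isAcyclic_of_star_subsingleton
    (hS : ∀ (b₁ b₂ : G.Branch) (v : G.Vertex), G.abuts b₁ = some v → G.abuts b₂ = some v → b₁ = b₂) :
    G.subdivision.IsAcyclic := by
  apply isAcyclic_fromRel_of_cut
  intro x y hxy
  rcases hxy with ⟨b⟩ | ⟨b, u, hb⟩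
  · -- the adjacency (edge of `b`) — (branch `b`): cut off `b` together with its vertex
    refine ⟨{z | z = Sum.inr (Sum.inr b) ∨ ∃ u, G.abuts b = some u ∧ z = Sum.inl u}, ?_, ?_⟩
    · intro hiff
      have h2 : (Sum.inr (Sum.inr b) : G.Node) ∈
          {z : G.Node | z = Sum.inr (Sum.inr b) ∨ ∃ u, G.abuts b = some u ∧ z = Sum.inl u} :=
        Or.inl rfl
      rcases hiff.mpr h2 with h1 | ⟨u, _, h1⟩
      · simp at h1
      · simp at h1
    · intro x' y' hr hne
      rcases hr with ⟨c⟩ | ⟨c, u, hc⟩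
      · constructor
        · rintro (h1 | ⟨u, _, h1⟩)
          · simp at h1
          · simp at h1
        · rintro (h1 | ⟨u, _, h1⟩)
          · have hcb : c = b := by simpa using h1
            subst hcb
            exact absurd rfl hne
          · simp at h1
      · constructor
        · rintro (h1 | ⟨u', _, h1⟩)
          · have hcb : c = b := by simpa using h1
            subst hcb
            exact Or.inr ⟨u, hc, rfl⟩
          · simp at h1
        · rintro (h1 | ⟨u', hu', h1⟩)
          · simp at h1
          · have huu : u = u' := by simpa using h1
            subst huu
            have hcb : c = b := hS c b u hc hu'
            subst hcb
            exact Or.inl rfl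
  · -- the adjacency (branch `b`) — (vertex `u`): cut off the vertex alone
    refine ⟨{z | z = Sum.inl u}, ?_, ?_⟩
    · intro hiff
      have h1 : (Sum.inr (Sum.inr b) : G.Node) ∈ {z : G.Node | z = Sum.inl u} := hiff.mpr rfl
      simp at h1
    · intro x' y' hr hne
      rcases hr with ⟨c⟩ | ⟨c, u', hc⟩
      · constructor
        · intro h1
          simp at h1
        · intro h1
          simp at h1
      · constructor
        · intro h1
          simp at h1
        · intro h1
          have huu : u' = u := by simpa using h1
          subst huu
          have hcb : c = b := hS c b u' hc hb
          subst hcb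
          exact absurd rfl hne

/-- If every edge of `G` has at most one abutting branch, the barycentric subdivision of `G` is
acyclic.  Applies to `G[v]` (p. 13: the edges `e'_{b_v}` have verticial cardinality `1`).
[cite: MochizukiSemiAnbd2006, §1 p.13] -/
theorem subdivision_isAcyclic_of_vertCard_le_one
    (hV : ∀ b₁ b₂ : G.Branch, G.edgeOf b₁ = G.edgeOf b₂ → (G.abuts b₁).isSome →
      (G.abuts b₂).isSome → b₁ = b₂) :
    G.subdivision.IsAcyclic := by
  apply isAcyclic_fromRel_of_cut
  intro x y hxy
  rcases hxy with ⟨b⟩ | ⟨b, u, hb⟩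
  · -- the adjacency (edge `e` of `b`) — (branch `b`)
    cases hb : G.abuts b with
    | none =>
      -- `b` abuts to nothing: cut off `b` alone
      refine ⟨{z | z = Sum.inr (Sum.inr b)}, ?_, ?_⟩
      · intro hiff
        have h1 : (Sum.inr (Sum.inl (G.edgeOf b)) : G.Node) ∈
            {z : G.Node | z = Sum.inr (Sum.inr b)} := hiff.mpr rfl
        simp at h1
      · intro x' y' hr hne
        rcases hr with ⟨c⟩ | ⟨c, u', hc⟩
        · constructor
          · intro h1
            simp at h1
          · intro h1
            have hcb : c = b := by simpa using h1
            subst hcb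
            exact absurd rfl hne
        · constructor
          · intro h1
            have hcb : c = b := by simpa using h1
            subst hcb
            rw [hb] at hc
            cases hc
          · intro h1
            simp at h1
    | some u =>
      -- `b` abuts to `u`: cut off the edge together with its other branch
      refine ⟨{z | z = Sum.inr (Sum.inl (G.edgeOf b)) ∨
        ∃ c, G.edgeOf c = G.edgeOf b ∧ c ≠ b ∧ z = Sum.inr (Sum.inr c)}, ?_, ?_⟩
      · intro hiff
        have h1 : (Sum.inr (Sum.inl (G.edgeOf b)) : G.Node) ∈
            {z : G.Node | z = Sum.inr (Sum.inl (G.edgeOf b)) ∨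
              ∃ c, G.edgeOf c = G.edgeOf b ∧ c ≠ b ∧ z = Sum.inr (Sum.inr c)} := Or.inl rfl
        rcases hiff.mp h1 with h2 | ⟨c, _, hcb, h2⟩
        · simp at h2
        · have : b = c := by simpa using h2
          exact hcb this.symm
      · intro x' y' hr hne
        rcases hr with ⟨c⟩ | ⟨c, u', hc⟩
        · by_cases hce : G.edgeOf c = G.edgeOf b
          · have hcb : c ≠ b := by
              rintro rfl
              exact hne rfl
            constructor
            · intro _
              exact Or.inr ⟨c, hce, hcb, rfl⟩
            · intro _
              exact Or.inl (by rw [hce])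
          · constructor
            · rintro (h1 | ⟨c', _, _, h1⟩)
              · exact absurd (by simpa using h1) hce
              · simp at h1
            · rintro (h1 | ⟨c', hc'e, _, h1⟩)
              · simp at h1
              · have hcc : c = c' := by simpa using h1
                subst hcc
                exact absurd hc'e hce
        · constructor
          · rintro (h1 | ⟨c', hc'e, hc'b, h1⟩)
            · simp at h1
            · have hcc : c = c' := by simpa using h1
              subst hcc
              have h3 : c = b := hV c b hc'e (by rw [hc]; rfl) (by rw [hb]; rfl)
              exact absurd h3 hc'b
          · intro h1
            simp at h1
  · -- the adjacency (branch `b`) — (vertex `u`): cut off the edge of `b` with all its branches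
    refine ⟨{z | z = Sum.inr (Sum.inl (G.edgeOf b)) ∨
      ∃ c, G.edgeOf c = G.edgeOf b ∧ z = Sum.inr (Sum.inr c)}, ?_, ?_⟩
    · intro hiff
      have h1 : (Sum.inr (Sum.inr b) : G.Node) ∈
          {z : G.Node | z = Sum.inr (Sum.inl (G.edgeOf b)) ∨
            ∃ c, G.edgeOf c = G.edgeOf b ∧ z = Sum.inr (Sum.inr c)} := Or.inr ⟨b, rfl, rfl⟩
      rcases hiff.mp h1 with h2 | ⟨c, _, h2⟩
      · simp at h2
      · simp at h2
    · intro x' y' hr hne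
      rcases hr with ⟨c⟩ | ⟨c, u', hc⟩
      · constructor
        · rintro (h1 | ⟨c', _, h1⟩)
          · exact Or.inr ⟨c, by simpa using h1, rfl⟩
          · simp at h1
        · rintro (h1 | ⟨c', hc'e, h1⟩)
          · simp at h1
          · have hcc : c = c' := by simpa using h1
            subst hcc
            exact Or.inl (by rw [hc'e])
      · constructor
        · rintro (h1 | ⟨c', hc'e, h1⟩)
          · simp at h1
          · have hcc : c = c' := by simpa using h1
            subst hcc
            have h3 : c = b := hV c b hc'e (by rw [hc]; rfl) (by rw [hb]; rfl)
            subst h3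
            rw [hb] at hc
            cases hc
            exact absurd rfl hne
        · intro h1
          simp at h1

end SemiGraph

end Literature.AnabelianGeometry.SemiGraphs
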